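import Summits.NavierStokesRegularity.NavierStokesRegularity.Theses.HardyPointSink
import Literature.Analysis.FluidPDE.NSCriticalClosureBesovKatoClass

/-!
# Route HardyPointSink — `BlowupHasSingularPoint` (item stmt-NavierStokesRegularity-9116)

LOSS OF SMOOTHNESS HAPPENS AT A POINT. For `ν > 0`, `T > 0` and a classical solution `(u, p)` of
the unforced Navier–Stokes system on `ℝ³ × [0, T)` (`IsClassicalNSSolutionOn (Ico 0 T) ν 0 u p`)
which is Leray–Hopf on `[0, T)` from the rapidly decaying datum `u 0`: if `u` has no smooth
extension past `T`, then some `xs ∈ ℝ³` is a backward singular point at time `T`, i.e. `u` is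
essentially unbounded on every parabolic cylinder `Q_r(T, xs) = (T − r², T) × B(xs, r)`, `r > 0`.

## Proof (pure bookkeeping over proved tree theorems)

* `Literature.Analysis.FluidPDE.exists_singularPoint_of_classical_of_not_hasSmoothExtensionPast`
  (`NSCriticalClosureBesovKatoClass.lean`; Lemarié-Rieusset 2016, Thm. 15.1 (C)): such a `u` is the
  Kato `C_t L³` solution of its datum on `[0, T)` (`isKatoSolutionOn_of_classical`), `T` is its
  maximal Kato time (`not_isKatoSolutionOn_of_not_hasSmoothExtensionPast`: a Kato solution on a
  longer interval is smooth, agrees with `u` on `(0, T)`, and glues to a classical continuation),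
  and the far-field bound of Kato solutions plus compactness of closed balls
  (`lemarieRieusset_singular_point_of_blowup_holds`) give `xs` with
  `‖u‖_{L^∞(Q_r(T, xs))} = ∞` for all `0 < r`, `r² < T`.
* `Literature.Analysis.FluidPDE.eLpNorm_top_parabolicCylinder_eq_top_of_small`
  (`NSLerayHopfSereginMild.lean`): the essential supremum over `Q_r(T, xs)` is monotone in `r`,
  so small radii suffice and the restriction `r² < T` is removed.

No named fact is taken as a hypothesis; nothing is restated.

## References

* P. G. Lemarié-Rieusset, *The Navier–Stokes Problem in the 21st Century*, CRC Press (2016),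
  Thm. 15.1 (C) and its proof, PDF pp. 565–566. [LemarieRieusset2016]
* W. Rusin, V. Šverák, J. Funct. Anal. 260 (2011) = arXiv:0911.0500, §4. [RusinSverak2011]
* J. C. Robinson, J. L. Rodrigo, W. Sadowski, *The Three-Dimensional Navier–Stokes Equations*,
  CUP (2016), Thm. 8.17. [RobinsonRodrigoSadowski2016]
-/

noncomputable section

open Literature.Analysis.FluidPDE MeasureTheory Set Function

-- the summit and its single sub-problem share the name (CONVENTIONS §1), as in every Theorems file
set_option linter.dupNamespace false

namespace Summit.NavierStokesRegularity.NavierStokesRegularity.Theorems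

/-- **`BlowupHasSingularPoint`** (item stmt-NavierStokesRegularity-9116, support of route
HardyPointSink): for `ν > 0`, `T > 0` and a classical unforced Navier–Stokes solution `(u, p)` on
`ℝ³ × [0, T)` which is Leray–Hopf on `[0, T)` from the rapidly decaying datum `u 0` and has no
smooth extension past `T`, there is `xs ∈ ℝ³` with
`‖u‖_{L^∞(Q_r(T, xs))} = ∞` for every `r > 0` (Lemarié-Rieusset 2016, Thm. 15.1 (C), in the tree
as `exists_singularPoint_of_classical_of_not_hasSmoothExtensionPast`, with the restriction
`r² < T` removed by monotonicity of the cylinder norm in the radius,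
`eLpNorm_top_parabolicCylinder_eq_top_of_small`). -/
theorem hardyPointSink_blowupHasSingularPoint_proof :
    Summit.NavierStokesRegularity.NavierStokesRegularity.Theses.HardyPointSink.BlowupHasSingularPoint := by
  unfold Summit.NavierStokesRegularity.NavierStokesRegularity.Theses.HardyPointSink.BlowupHasSingularPoint
  intro ν T hν hT u p hsol hLH h₀ hext
  obtain ⟨xs, hxs⟩ :=
    exists_singularPoint_of_classical_of_not_hasSmoothExtensionPast hν hT hsol hLH h₀ hext
  exact ⟨xs, fun r hr => eLpNorm_top_parabolicCylinder_eq_top_of_small hT hxs hr⟩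

end Summit.NavierStokesRegularity.NavierStokesRegularity.Theorems

end
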